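import Summits.AnomalousDissipation.AnomalousDissipation.Theorems.ScalarAnomalySteadySourceFormal.Negative.WienOuter
import Summits.AnomalousDissipation.AnomalousDissipation.Theorems.ScalarAnomalySteadySourceFormal.Negative.CellNoGo

/-!
# Negative knowledge for the crux `ScalarAnomalySteadySourceFormal` (stmt-AnomalousDissipation-0448), X-g:
# NO-GO — uniformly Wiener-class (e.g. uniformly `H^{3+}`) stirring carries no anomaly

Certified copy of §12.7 of the cdisprove work file.  **Theorem (`wiener_not_anomalous`).**  Let `h`
be smooth with zero mean, `ν_j → 0⁺`, and let the velocities be Wiener-class fields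
`u_j(s) = wienField (C_j s)` — arbitrary continuous coefficient paths `C_j s : ℤ² → ℂ²`, conjugate
symmetric (reality) and transversal (`q · C_j(s,q) = 0`, divergence-free), dominated UNIFORMLY IN `j`
by one majorant `a` with `∑ a_q`, `∑ r_q a_q`, `∑ r_q² a_q < ∞` (`r_q = |q|_∞`).  Then for arbitrary
`L²` data and ANY weak solutions of the crux's class, bounded variance excludes a dissipation floor.
The class contains every family bounded in `C_t H^{3+δ}_x` (or `C_t W^{2+δ,∞}`-Wiener) uniformly in
`j`, with infinite Fourier support — so a crux witness must be UNBOUNDED in every such norm: its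
stirring develops ever finer scales as `ν_j → 0` (consistent with, and much weaker than, the
Batchelor-scale heuristics; but a theorem).

Proof: per-`T` inequality of `Negative.WienOuter` + harmonic inner pigeonhole with `q`-dependent
layer widths (`exists_wInner_small`: `∑_K K⁻¹ ∑' q 2a_q (K+r_q) ∫G_{K,q} ≤ 4(A₁+A₂) ∫‖θ‖²`) +
`wien_timeMean_diss_le` + the member/family endgame of `Negative.CellQuant`/`CellNoGo`
(`Negative.ShearHonest.honest_variance`).  Corollary through `Negative.KillShape`:
`not_anomalous_of_isCandidate_wiener`.

Supports stmt-AnomalousDissipation-0448.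
-/

set_option linter.dupNamespace false

noncomputable section

open scoped BigOperators Topology ENNReal NNReal InnerProductSpace ContDiff
open Filter Set Function MeasureTheory UnitAddTorus Complex

namespace Summit.AnomalousDissipation.AnomalousDissipation.Theorems.ScalarAnomalySteadySourceFormal.Negative

open Literature.Analysis
open Literature.Analysis.FunctionSpaces Literature.Analysis.FunctionSpaces.Torus
open Literature.Analysis.FluidPDE Literature.Analysis.FluidPDE.Torus

/-- The frequency lattice `ℤ²` (local notation). -/
local notation "ℤ²" => Fin 2 → ℤ

section WInner

variable {ν : ℝ} {C : ℝ → ℤ² → EuclideanSpace ℂ (Fin 2)} {a : ℤ² → ℝ}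
  {u : ℝ → UnitAddTorus (Fin 2) → EuclideanSpace ℝ (Fin 2)} {h θ₀ : UnitAddTorus (Fin 2) → ℝ}
  {θ : ℝ → UnitAddTorus (Fin 2) → ℝ}

/-- **Harmonic inner pigeonhole with shift-dependent layer widths**: among `K = K₀ + x`, `x < n`
(`K₀ ≥ 1`), one has `∑' q ∫ wInner a K y q ≤ 4 (A₁ + A₂) ∫‖θ‖² / ∑_{x<n} (K₀+x)⁻¹`,
`A₁ = ∑ r_q a_q`, `A₂ = ∑ r_q² a_q`. [folklore] -/
theorem exists_wInner_small (hw : IsWeakScalarTransportForced ν u (fun _ => h) θ₀ θ) (hCa : ∀ s q, ‖C s q‖ ≤ a q)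
    (hsa : Summable a) (hsa1 : Summable fun q => (qrad q : ℝ) * a q) (hsa2 : Summable fun q => (qrad q : ℝ) ^ 2 * a q)
    {T : ℝ} (hT : 0 < T) {K₀ : ℕ} (hK₀ : 1 ≤ K₀) {n : ℕ} (hn : 1 ≤ n) :
    ∃ x ∈ Finset.range n, ∑' q, ∫ t in Ioo 0 T, wInner a ((K₀ : ℤ) + x) (modes θ t) q ≤
      4 * ((∑' q, (qrad q : ℝ) * a q) + ∑' q, (qrad q : ℝ) ^ 2 * a q) * (∫ t in Ioo 0 T, scalarL2Sq (θ t)) /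
        ∑ x ∈ Finset.range n, ((K₀ : ℝ) + x)⁻¹ := by
  classical
  have hwT := hw T hT
  have ha : ∀ q, 0 ≤ a q := fun q => (norm_nonneg _).trans (hCa 0 q)
  have hK₀1 : (1 : ℝ) ≤ K₀ := by exact_mod_cast hK₀
  set V : ℝ := ∫ t in Ioo 0 T, scalarL2Sq (θ t) with hV
  have hV0 : 0 ≤ V := setIntegral_nonneg measurableSet_Ioo fun _ _ => scalarL2Sq_nonneg _
  have hK0 : ∀ x : ℕ, (0 : ℤ) ≤ (K₀ : ℤ) + x := fun x => by positivity
  -- the weighted total: `∑_x (K₀+x)⁻¹ X_{K₀+x} ≤ 4 (A₁ + A₂) V`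
  have hsum : ∑ x ∈ Finset.range n, ((K₀ : ℝ) + x)⁻¹ * ∑' q, ∫ t in Ioo 0 T, wInner a ((K₀ : ℤ) + x) (modes θ t) q ≤
      4 * ((∑' q, (qrad q : ℝ) * a q) + ∑' q, (qrad q : ℝ) ^ 2 * a q) * V := by
    have hsx : ∀ x ∈ Finset.range n, Summable fun q => ((K₀ : ℝ) + x)⁻¹ * ∫ t in Ioo 0 T, wInner a ((K₀ : ℤ) + x) (modes θ t) q :=
      fun x _ => (summable_integral_wInner hwT hCa hsa hsa1 (hK0 x)).mul_left _
    simp_rw [← tsum_mul_left]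
    rw [← Summable.tsum_finsetSum hsx, show 4 * ((∑' q, (qrad q : ℝ) * a q) + ∑' q, (qrad q : ℝ) ^ 2 * a q) * V =
      ∑' q, (4 * V * ((qrad q : ℝ) * a q) + 4 * V * ((qrad q : ℝ) ^ 2 * a q)) by
        rw [Summable.tsum_add (hsa1.mul_left _) (hsa2.mul_left _), tsum_mul_left, tsum_mul_left]; ring]
    refine Summable.tsum_le_tsum (fun q => ?_) (summable_sum hsx) ((hsa1.mul_left _).add (hsa2.mul_left _))
    -- fixed shift `q`
    have hr : (0 : ℝ) ≤ qrad q := (qrad q).cast_nonneg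
    have haq := ha q
    have hlay := sum_Ico_integral_slayerSum_le_tail hw hT (qrad q) (K₀ : ℤ) n
    have htl := integral_sqTail_le hw hT ((K₀ : ℤ) - qrad q)
    have e1 : ∀ x ∈ Finset.range n, ((K₀ : ℝ) + x)⁻¹ * ∫ t in Ioo 0 T, wInner a ((K₀ : ℤ) + x) (modes θ t) q =
        2 * a q * ((((K₀ : ℤ) + x : ℤ) : ℝ) + qrad q) / ((K₀ : ℝ) + x) *
          ∫ t in Ioo 0 T, slayerSum ((K₀ : ℤ) + x - qrad q) ((K₀ : ℤ) + x + qrad q) (modes θ t) := by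
      intro x _
      unfold wInner
      rw [integral_const_mul, integral_const_mul]
      push_cast
      ring
    rw [Finset.sum_congr rfl e1]
    have e2 : ∀ x ∈ Finset.range n, 2 * a q * ((((K₀ : ℤ) + x : ℤ) : ℝ) + qrad q) / ((K₀ : ℝ) + x) *
        ∫ t in Ioo 0 T, slayerSum ((K₀ : ℤ) + x - qrad q) ((K₀ : ℤ) + x + qrad q) (modes θ t) ≤
        2 * a q * (1 + qrad q) * ∫ t in Ioo 0 T, slayerSum ((K₀ : ℤ) + x - qrad q) ((K₀ : ℤ) + x + qrad q) (modes θ t) := by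
      intro x _
      have h0 := setIntegral_nonneg (μ := volume) (s := Ioo 0 T) measurableSet_Ioo
        (fun t _ => slayerSum_nonneg ((K₀ : ℤ) + x - qrad q) ((K₀ : ℤ) + x + qrad q) (modes θ t))
      refine mul_le_mul_of_nonneg_right ?_ h0
      have hKx : (1 : ℝ) ≤ (K₀ : ℝ) + x := by have : (0:ℝ) ≤ x := x.cast_nonneg; linarith
      have hfrac : ((((K₀ : ℤ) + x : ℤ) : ℝ) + qrad q) / ((K₀ : ℝ) + x) ≤ 1 + qrad q := by
        rw [div_le_iff₀ (by linarith)]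
        push_cast
        nlinarith
      rw [mul_div_assoc]
      exact mul_le_mul_of_nonneg_left hfrac (by positivity)
    refine (Finset.sum_le_sum e2).trans ?_
    rw [← Finset.mul_sum]
    have e3 : ∑ x ∈ Finset.range n, ∫ t in Ioo 0 T, slayerSum ((K₀ : ℤ) + x - qrad q) ((K₀ : ℤ) + x + qrad q) (modes θ t) =
        ∑ K ∈ Finset.Ico (K₀ : ℤ) ((K₀ : ℤ) + n), ∫ t in Ioo 0 T, slayerSum (K - qrad q) (K + qrad q) (modes θ t) := by
      rw [← image_natCast_add_range, Finset.sum_image fun x _ y _ hxy => by simpa using hxy]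
    rw [e3]
    calc 2 * a q * (1 + qrad q) * ∑ K ∈ Finset.Ico (K₀ : ℤ) ((K₀ : ℤ) + n), ∫ t in Ioo 0 T, slayerSum (K - qrad q) (K + qrad q) (modes θ t)
        ≤ 2 * a q * (1 + qrad q) * (2 * qrad q * V) := by
          refine mul_le_mul_of_nonneg_left (hlay.trans ?_) (by positivity)
          exact mul_le_mul_of_nonneg_left htl (by positivity)
      _ = 4 * V * ((qrad q : ℝ) * a q) + 4 * V * ((qrad q : ℝ) ^ 2 * a q) := by ring
  have hne : (Finset.range n).Nonempty := Finset.nonempty_range_iff.2 (by omega)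
  obtain ⟨x, hx, hle⟩ := exists_weighted_le hne (w := fun x : ℕ => (K₀ : ℝ) + x)
    (a := fun x => ((K₀ : ℝ) + x)⁻¹ * ∑' q, ∫ t in Ioo 0 T, wInner a ((K₀ : ℤ) + x) (modes θ t) q)
    (fun x _ => by have h0 : (0:ℝ) ≤ x := x.cast_nonneg
                   linarith) hsum
  refine ⟨x, hx, ?_⟩
  have hKx : (0 : ℝ) < (K₀ : ℝ) + x := by have : (0:ℝ) ≤ x := x.cast_nonneg; linarith
  have e : ((K₀ : ℝ) + x) * (((K₀ : ℝ) + x)⁻¹ * ∑' q, ∫ t in Ioo 0 T, wInner a ((K₀ : ℤ) + x) (modes θ t) q) =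
      ∑' q, ∫ t in Ioo 0 T, wInner a ((K₀ : ℤ) + x) (modes θ t) q := by
    rw [← mul_assoc, mul_inv_cancel₀ hKx.ne', one_mul]
  rw [e] at hle
  exact hle

/-- **Per-`T` estimate of the dissipation MEAN** under Wiener-class stirring, inner pigeonhole done:
`⟨ν‖∇θ‖²⟩_T ≤ ‖θ₀‖²/(2T) + (8π²ν(K₀+n)² + 8π(A₁+A₂)/H + η₀/2) ⟨‖θ‖²⟩_T + η₀/2`,
`H = ∑_{x<n}(K₀+x)⁻¹`, `η₀ = η_out(K₀,K₀)`. [folklore] -/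
theorem wien_timeMean_diss_le (hν : 0 < ν) (hw : IsWeakScalarTransportForced ν u (fun _ => h) θ₀ θ)
    (hu : ∀ s, u s = wienField (C s)) (hCa : ∀ s q, ‖C s q‖ ≤ a q) (hsa : Summable a)
    (hsa1 : Summable fun q => (qrad q : ℝ) * a q) (hsa2 : Summable fun q => (qrad q : ℝ) ^ 2 * a q)
    (hsymm : ∀ s q, C s (-q) = EuclideanSpace.conjVec (C s q)) (hcont : ∀ q, Continuous fun s => C s q)
    (htrans : ∀ s q, zdot q (C s q) = 0) (hh : MemLp h 2 volume) (hθ₀ : MemLp θ₀ 2 volume)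
    {K₀ : ℕ} (hK₀ : 1 ≤ K₀) {n : ℕ} (hn : 1 ≤ n) {T : ℝ} (hT : 0 < T) :
    timeMean (fun t => ν * (eScalarGradNormSq (θ t)).toReal) T ≤
      scalarL2Sq θ₀ / (2 * T) +
        (8 * Real.pi ^ 2 * ν * ((K₀ : ℝ) + n) ^ 2 +
          8 * Real.pi * ((∑' q, (qrad q : ℝ) * a q) + ∑' q, (qrad q : ℝ) ^ 2 * a q) / (∑ x ∈ Finset.range n, ((K₀ : ℝ) + x)⁻¹) +
          sourceTailMass K₀ K₀ h / 2) * timeMean (fun t => scalarL2Sq (θ t)) T +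
        sourceTailMass K₀ K₀ h / 2 := by
  have hwT := hw T hT
  have hK₀1 : (1 : ℝ) ≤ K₀ := by exact_mod_cast hK₀
  have hH0 : 0 < ∑ x ∈ Finset.range n, ((K₀ : ℝ) + x)⁻¹ := Finset.sum_pos (fun x _ => by
    have h0 : (0:ℝ) ≤ x := x.cast_nonneg
    exact inv_pos.2 (by linarith)) (Finset.nonempty_range_iff.2 (by omega))
  have ha : ∀ q, 0 ≤ a q := fun q => (norm_nonneg _).trans (hCa 0 q)
  have hA0 : 0 ≤ (∑' q, (qrad q : ℝ) * a q) + ∑' q, (qrad q : ℝ) ^ 2 * a q :=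
    add_nonneg (tsum_nonneg fun q => by have := ha q; positivity) (tsum_nonneg fun q => by have := ha q; positivity)
  obtain ⟨x, hx, hxle⟩ := exists_wInner_small hw hCa hsa hsa1 hsa2 hT hK₀ hn
  rw [Finset.mem_range] at hx
  obtain ⟨K, hKdef⟩ : ∃ K : ℤ, K = (K₀ : ℤ) + x := ⟨_, rfl⟩
  rw [← hKdef] at hxle
  have hK0 : (0 : ℤ) ≤ K := by rw [hKdef]; positivity
  have hper := wien_perT_dissipation_le hw hν.le hu hCa hsa hsa1 hsa2 hsymm hcont htrans hh hθ₀ hK0 hT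
  have hV0 : 0 ≤ ∫ t in Ioo 0 T, scalarL2Sq (θ t) := setIntegral_nonneg measurableSet_Ioo fun _ _ => scalarL2Sq_nonneg _
  have hX0 : 0 ≤ ∑' q, ∫ t in Ioo 0 T, wInner a K (modes θ t) q := tsum_nonneg fun q => integral_wInner_nonneg hCa hK0 T q
  have hW0 : 0 ≤ ∫ t in Ioo 0 T, Real.sqrt (scalarL2Sq (θ t)) := setIntegral_nonneg measurableSet_Ioo fun _ _ => Real.sqrt_nonneg _
  have hB0 : 0 ≤ scalarL2Sq θ₀ + 16 * Real.pi ^ 2 * ν * K ^ 2 * (∫ t in Ioo 0 T, scalarL2Sq (θ t)) +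
      4 * Real.pi * (∑' q, ∫ t in Ioo 0 T, wInner a K (modes θ t) q) +
      2 * sourceTailMass K K h * ∫ t in Ioo 0 T, Real.sqrt (scalarL2Sq (θ t)) := by
    have := scalarL2Sq_nonneg θ₀; have := sourceTailMass_nonneg K K h; have := Real.pi_pos
    positivity
  have hIfin : (∫⁻ t in Ioo 0 T, eScalarGradNormSq (θ t)) ≠ ⊤ := by
    intro htop
    rw [htop, ENNReal.mul_top (by simpa using hν)] at hper
    exact ENNReal.ofReal_ne_top (top_le_iff.1 hper)
  have hreal := ENNReal.toReal_le_of_le_ofReal hB0 hper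
  rw [ENNReal.toReal_mul, ENNReal.toReal_ofReal (by positivity)] at hreal
  -- abbreviations
  set V : ℝ := ∫ t in Ioo 0 T, scalarL2Sq (θ t) with hV
  set η₀ := sourceTailMass K₀ K₀ h with hη₀
  have hη₀0 : 0 ≤ η₀ := sourceTailMass_nonneg _ _ _
  set H : ℝ := ∑ x ∈ Finset.range n, ((K₀ : ℝ) + x)⁻¹ with hH
  set I : ℝ≥0∞ := ∫⁻ t in Ioo 0 T, eScalarGradNormSq (θ t) with hI
  set W : ℝ := ∫ t in Ioo 0 T, Real.sqrt (scalarL2Sq (θ t)) with hW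
  set X : ℝ := ∑' q, ∫ t in Ioo 0 T, wInner a K (modes θ t) q with hX
  set A : ℝ := (∑' q, (qrad q : ℝ) * a q) + ∑' q, (qrad q : ℝ) ^ 2 * a q with hA
  have hW' : W ≤ (T + V) / 2 := by
    have hi1 : IntegrableOn (fun _ : ℝ => (1 : ℝ)) (Ioo 0 T) volume := integrableOn_const (hs := measure_Ioo_lt_top.ne)
    have h1 : ∫ t in Ioo 0 T, Real.sqrt (scalarL2Sq (θ t)) ≤ ∫ t in Ioo 0 T, (1 + scalarL2Sq (θ t)) / 2 := by
      refine integral_mono_ae (forced_integrableOn_sqrt_scalarL2Sq hwT)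
        ((hi1.add (forced_integrableOn_scalarL2Sq hwT)).div_const _) (Eventually.of_forall fun t => ?_)
      have h0 := scalarL2Sq_nonneg (θ t)
      nlinarith [Real.sq_sqrt h0, sq_nonneg (Real.sqrt (scalarL2Sq (θ t)) - 1), Real.sqrt_nonneg (scalarL2Sq (θ t))]
    rw [integral_div, integral_add hi1 (forced_integrableOn_scalarL2Sq hwT),
      setIntegral_const, Real.volume_real_Ioo_of_le hT.le, sub_zero, smul_eq_mul, mul_one] at h1
    exact h1
  have hη : sourceTailMass K K h ≤ η₀ := sourceTailMass_mono_sq hh (by rw [hKdef]; omega)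
  have hK2 : (K : ℝ) ^ 2 ≤ ((K₀ : ℝ) + n) ^ 2 := by
    have h1 : (K : ℝ) < (K₀ : ℝ) + n := by rw [hKdef]; push_cast; exact_mod_cast (by omega : K₀ + x < K₀ + n)
    have h2 : (0 : ℝ) ≤ K := by exact_mod_cast hK0
    nlinarith
  have hXw : X ≤ 4 * A * V / H := hxle
  have hπ := Real.pi_pos
  have s1 : 4 * Real.pi * X ≤ 4 * Real.pi * (4 * A * V / H) := mul_le_mul_of_nonneg_left hXw (by positivity)
  have s2 : 16 * Real.pi ^ 2 * ν * (K : ℝ) ^ 2 * V ≤ 16 * Real.pi ^ 2 * ν * ((K₀ : ℝ) + n) ^ 2 * V := by gcongr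
  have s3 : 2 * sourceTailMass K K h * W ≤ 2 * η₀ * ((T + V) / 2) :=
    mul_le_mul (by linarith) hW' hW0 (by positivity)
  have hB2 : 2 * ν * I.toReal ≤ scalarL2Sq θ₀ + 16 * Real.pi ^ 2 * ν * ((K₀ : ℝ) + n) ^ 2 * V +
      4 * Real.pi * (4 * A * V / H) + η₀ * (T + V) := by
    linarith [hreal, s1, s2, s3]
  have htm : timeMean (fun t => ν * (eScalarGradNormSq (θ t)).toReal) T = T⁻¹ * (ν * I.toReal) :=
    timeMean_diss_eq hw hT hIfin
  have htmV : timeMean (fun t => scalarL2Sq (θ t)) T = T⁻¹ * V := by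
    rw [timeMean, intervalIntegral.integral_of_le hT.le, integral_Ioc_eq_integral_Ioo]
  rw [htm, htmV]
  have hTi : 0 < T⁻¹ := inv_pos.2 hT
  have e2 : T⁻¹ * ((scalarL2Sq θ₀ + 16 * Real.pi ^ 2 * ν * ((K₀ : ℝ) + n) ^ 2 * V +
      4 * Real.pi * (4 * A * V / H) + η₀ * (T + V)) / 2) =
      scalarL2Sq θ₀ / (2 * T) + (8 * Real.pi ^ 2 * ν * ((K₀ : ℝ) + n) ^ 2 + 8 * Real.pi * A / H + η₀ / 2) * (T⁻¹ * V) + η₀ / 2 := by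
    field_simp
    ring
  calc T⁻¹ * (ν * I.toReal) ≤ T⁻¹ * ((scalarL2Sq θ₀ + 16 * Real.pi ^ 2 * ν * ((K₀ : ℝ) + n) ^ 2 * V +
      4 * Real.pi * (4 * A * V / H) + η₀ * (T + V)) / 2) :=
        mul_le_mul_of_nonneg_left (by linarith) hTi.le
    _ = _ := e2

/-- **One Wiener-stirred member cannot carry the floor.** [folklore] -/
theorem wien_member_no_floor (hν : 0 < ν) (hw : IsWeakScalarTransportForced ν u (fun _ => h) θ₀ θ)
    (hu : ∀ s, u s = wienField (C s)) (hCa : ∀ s q, ‖C s q‖ ≤ a q) (hsa : Summable a)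
    (hsa1 : Summable fun q => (qrad q : ℝ) * a q) (hsa2 : Summable fun q => (qrad q : ℝ) ^ 2 * a q)
    (hsymm : ∀ s q, C s (-q) = EuclideanSpace.conjVec (C s q)) (hcont : ∀ q, Continuous fun s => C s q)
    (htrans : ∀ s q, zdot q (C s q) = 0) (hh : IsSmooth h) (hmean : HasZeroMean h) (hθ₀ : MemLp θ₀ 2 volume)
    {K₀ n : ℕ} (hK₀ : 1 ≤ K₀) (hn : 1 ≤ n) {ε E' E : ℝ} (hε : 0 < ε) (hEE' : E < E')
    (hP₁ : 8 * Real.pi ^ 2 * ν * ((K₀ : ℝ) + n) ^ 2 * E' ≤ ε / 8)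
    (hP₂ : 8 * Real.pi * ((∑' q, (qrad q : ℝ) * a q) + ∑' q, (qrad q : ℝ) ^ 2 * a q) * E' /
      (∑ x ∈ Finset.range n, ((K₀ : ℝ) + x)⁻¹) ≤ ε / 8)
    (hη : sourceTailMass K₀ K₀ h * ((1 + E') / 2) ≤ ε / 8)
    (hVb : longTimeAvgSup (fun t => scalarL2Sq (θ t)) ≤ E)
    (hfl : ε ≤ longTimeAvgSup (fun t => ν * (eScalarGradNormSq (θ t)).toReal)) : False := by
  have hh2 : MemLp h 2 volume := hh.memLp 2
  have hhi : Integrable h volume := hh.integrable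
  have hπ := Real.pi_pos
  have ha : ∀ q, 0 ≤ a q := fun q => (norm_nonneg _).trans (hCa 0 q)
  obtain ⟨η₀, hη₀⟩ : ∃ η₀ : ℝ, η₀ = sourceTailMass K₀ K₀ h := ⟨_, rfl⟩
  have hη₀0 : 0 ≤ η₀ := by rw [hη₀]; exact sourceTailMass_nonneg _ _ _
  obtain ⟨A, hAd⟩ : ∃ A : ℝ, A = (∑' q, (qrad q : ℝ) * a q) + ∑' q, (qrad q : ℝ) ^ 2 * a q := ⟨_, rfl⟩
  have hA0 : 0 ≤ A := by
    rw [hAd]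
    exact add_nonneg (tsum_nonneg fun q => by have := ha q; positivity) (tsum_nonneg fun q => by have := ha q; positivity)
  obtain ⟨P₁, hP₁d⟩ : ∃ P₁ : ℝ, P₁ = 8 * Real.pi ^ 2 * ν * ((K₀ : ℝ) + n) ^ 2 := ⟨_, rfl⟩
  obtain ⟨P₂, hP₂d⟩ : ∃ P₂ : ℝ, P₂ = 8 * Real.pi * A / (∑ x ∈ Finset.range n, ((K₀ : ℝ) + x)⁻¹) := ⟨_, rfl⟩
  have hHpos : 0 < ∑ x ∈ Finset.range n, ((K₀ : ℝ) + x)⁻¹ :=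
    Finset.sum_pos (fun x _ => by
      have h0 : (0:ℝ) ≤ x := x.cast_nonneg
      have h1' : (1:ℝ) ≤ K₀ := by exact_mod_cast hK₀
      exact inv_pos.2 (by linarith only [h0, h1'])) (Finset.nonempty_range_iff.2 (by omega))
  have hP₁0 : 0 ≤ P₁ := by rw [hP₁d]; exact mul_nonneg (mul_nonneg (by positivity) hν.le) (sq_nonneg _)
  have hP₂0 : 0 ≤ P₂ := by rw [hP₂d]; exact div_nonneg (by positivity) hHpos.le
  have hP₁E : P₁ * E' ≤ ε / 8 := by rw [hP₁d]; exact hP₁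
  have hP₂E : P₂ * E' ≤ ε / 8 := by
    rw [hP₂d, div_mul_eq_mul_div, hAd]; exact hP₂
  have h4 : η₀ / 2 * E' + η₀ / 2 ≤ ε / 8 := by
    have e : η₀ / 2 * E' + η₀ / 2 = η₀ * ((1 + E') / 2) := by ring
    rw [e, hη₀]; exact hη
  have hP0 : 0 ≤ P₁ + P₂ + η₀ / 2 := by linarith only [hP₁0, hP₂0, hη₀0]
  have hcoef : (P₁ + P₂ + η₀ / 2) * E' + η₀ / 2 ≤ 3 * ε / 8 := by
    have e : (P₁ + P₂ + η₀ / 2) * E' + η₀ / 2 = P₁ * E' + P₂ * E' + (η₀ / 2 * E' + η₀ / 2) := by ring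
    rw [e]; linarith only [hP₁E, hP₂E, h4]
  have hfin : ∀ T, 0 < T → ∫⁻ t in Ioo 0 T, eScalarGradNormSq (θ t) ≠ ⊤ := by
    intro T hT htop
    have hper := wien_perT_dissipation_le hw hν.le hu hCa hsa hsa1 hsa2 hsymm hcont htrans hh2 hθ₀ (K := 0) le_rfl hT
    rw [htop, ENNReal.mul_top (by simpa using hν)] at hper
    exact ENNReal.ofReal_ne_top (top_le_iff.1 hper)
  have hδ' : 0 < E' - E := by linarith only [hEE']
  have hhon := honest_variance hw hν hhi hmean (hθ₀.integrable one_le_two) hfin hε hfl hVb hδ'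
  rw [show E + (E' - E) = E' by ring] at hhon
  have hev : ∀ᶠ T in atTop, timeMean (fun t => ν * (eScalarGradNormSq (θ t)).toReal) T ≤ ε / 2 := by
    filter_upwards [hhon, eventually_gt_atTop (0 : ℝ), eventually_ge_atTop (4 * scalarL2Sq θ₀ / ε)]
      with T hVT hT0 hTθ
    have hest : timeMean (fun t => ν * (eScalarGradNormSq (θ t)).toReal) T ≤
        scalarL2Sq θ₀ / (2 * T) + (P₁ + P₂ + η₀ / 2) * timeMean (fun t => scalarL2Sq (θ t)) T + η₀ / 2 := by
      rw [hP₁d, hP₂d, hη₀, hAd]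
      exact wien_timeMean_diss_le hν hw hu hCa hsa hsa1 hsa2 hsymm hcont htrans hh2 hθ₀ hK₀ hn hT0
    have hVT0 : 0 ≤ timeMean (fun t => scalarL2Sq (θ t)) T := timeMean_nonneg (fun t => scalarL2Sq_nonneg _) hT0.le
    have h1 : scalarL2Sq θ₀ / (2 * T) ≤ ε / 8 := by
      rw [div_le_iff₀ (by positivity)]
      have hTθ' : 4 * scalarL2Sq θ₀ / ε ≤ T := hTθ
      rw [div_le_iff₀ hε] at hTθ'
      linarith only [hTθ']
    have h2 : (P₁ + P₂ + η₀ / 2) * timeMean (fun t => scalarL2Sq (θ t)) T + η₀ / 2 ≤ 3 * ε / 8 :=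
      le_trans (add_le_add (mul_le_mul_of_nonneg_left hVT hP0) le_rfl) hcoef
    linarith only [hest, h1, h2]
  have hfreq := frequently_le_timeMean_of_le_longTimeAvgSup hε (by positivity : (0 : ℝ) < ε / 4) hfl
  obtain ⟨T, hT1, hT2⟩ := (hfreq.and_eventually hev).exists
  linarith only [hT1, hT2, hε]

end WInner

section WienNoGo

variable {h : UnitAddTorus (Fin 2) → ℝ} {a : ℤ² → ℝ}

/-- **NO-GO THEOREM: uniformly Wiener-class stirring cannot witness the crux.**  See the file
docstring. [folklore] -/
theorem wiener_not_anomalous (hh : IsSmooth h) (hmean : HasZeroMean h)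
    (hsa : Summable a) (hsa1 : Summable fun q => (qrad q : ℝ) * a q) (hsa2 : Summable fun q => (qrad q : ℝ) ^ 2 * a q)
    {νs : ℕ → ℝ} (hν : ∀ j, 0 < νs j) (hν0 : Tendsto νs atTop (nhds 0))
    {Cs : ℕ → ℝ → ℤ² → EuclideanSpace ℂ (Fin 2)} (hCa : ∀ j s q, ‖Cs j s q‖ ≤ a q)
    (hsymm : ∀ j s q, Cs j s (-q) = EuclideanSpace.conjVec (Cs j s q)) (hcont : ∀ j q, Continuous fun s => Cs j s q)
    (htrans : ∀ j s q, zdot q (Cs j s q) = 0)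
    {us : ℕ → ℝ → UnitAddTorus (Fin 2) → EuclideanSpace ℝ (Fin 2)} (hu : ∀ j s, us j s = wienField (Cs j s))
    {θ₀s : ℕ → UnitAddTorus (Fin 2) → ℝ} (hθ₀ : ∀ j, MemLp (θ₀s j) 2 volume)
    {θs : ℕ → ℝ → UnitAddTorus (Fin 2) → ℝ}
    (hweak : ∀ j, IsWeakScalarTransportForced (νs j) (us j) (fun _ => h) (θ₀s j) (θs j))
    {E : ℝ} (hV : ∀ j, longTimeAvgSup (fun t => scalarL2Sq (θs j t)) ≤ E) :
    ¬ ∃ ε : ℝ, 0 < ε ∧ ∀ j, ε ≤ longTimeAvgSup (fun t => νs j * (eScalarGradNormSq (θs j t)).toReal) := by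
  rintro ⟨ε, hε, hfl⟩
  have hh2 : MemLp h 2 volume := hh.memLp 2
  have ha : ∀ q, 0 ≤ a q := fun q => (norm_nonneg _).trans (hCa 0 0 q)
  obtain ⟨E', hE'⟩ : ∃ E' : ℝ, E' = max E 0 + 1 := ⟨_, rfl⟩
  have hE'0 : 0 < E' := by rw [hE']; have := le_max_right E 0; linarith only [this]
  have hEE' : E < E' := by rw [hE']; have := le_max_left E 0; linarith only [this]
  have hπ := Real.pi_pos
  obtain ⟨A, hAd⟩ : ∃ A : ℝ, A = (∑' q, (qrad q : ℝ) * a q) + ∑' q, (qrad q : ℝ) ^ 2 * a q := ⟨_, rfl⟩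
  have hA0 : 0 ≤ A := by
    rw [hAd]
    exact add_nonneg (tsum_nonneg fun q => by have := ha q; positivity) (tsum_nonneg fun q => by have := ha q; positivity)
  -- (a) tail cut-off
  obtain ⟨L, hL⟩ := sourceTailMass_small hh2 (η := ε / (4 * (1 + E'))) (by positivity)
  obtain ⟨K₀, hK₀⟩ : ∃ K₀ : ℕ, K₀ = max L 1 := ⟨_, rfl⟩
  have hK₀1 : 1 ≤ K₀ := by rw [hK₀]; exact le_max_right _ _
  have hηc : sourceTailMass K₀ K₀ h * ((1 + E') / 2) ≤ ε / 8 := by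
    have hle : sourceTailMass K₀ K₀ h ≤ ε / (4 * (1 + E')) :=
      (sourceTailMass_mono_sq hh2 (by rw [hK₀]; exact_mod_cast le_max_left L 1)).trans hL
    calc sourceTailMass K₀ K₀ h * ((1 + E') / 2) ≤ ε / (4 * (1 + E')) * ((1 + E') / 2) :=
          mul_le_mul_of_nonneg_right hle (by positivity)
      _ = ε / 8 := by field_simp; ring
  -- (b) harmonic window
  obtain ⟨n, hn1, hn⟩ := harmonic_window_unbounded (c := K₀) hK₀1 (8 * (8 * Real.pi * A * E') / ε)
  have hHpos : 0 < ∑ x ∈ Finset.range n, ((K₀ : ℝ) + x)⁻¹ :=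
    Finset.sum_pos (fun x _ => by
      have h0 : (0:ℝ) ≤ x := x.cast_nonneg
      have h1' : (1:ℝ) ≤ K₀ := by exact_mod_cast hK₀1
      exact inv_pos.2 (by linarith only [h0, h1'])) (Finset.nonempty_range_iff.2 (by omega))
  have hP₂ : 8 * Real.pi * A * E' / (∑ x ∈ Finset.range n, ((K₀ : ℝ) + x)⁻¹) ≤ ε / 8 := by
    rw [div_le_iff₀ hHpos]
    rw [div_le_iff₀ hε] at hn
    linarith only [hn]
  -- (c) the index `j`
  have hBc0 : 0 < 8 * Real.pi ^ 2 * ((K₀ : ℝ) + n) ^ 2 * E' := by positivity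
  obtain ⟨j, hj⟩ := ((tendsto_order.1 hν0).2 (ε / 8 / (8 * Real.pi ^ 2 * ((K₀ : ℝ) + n) ^ 2 * E')) (by positivity)).exists
  have hP₁ : 8 * Real.pi ^ 2 * νs j * ((K₀ : ℝ) + n) ^ 2 * E' ≤ ε / 8 := by
    have h1 : νs j < ε / 8 / (8 * Real.pi ^ 2 * ((K₀ : ℝ) + n) ^ 2 * E') := hj
    rw [lt_div_iff₀ hBc0] at h1
    have e : 8 * Real.pi ^ 2 * νs j * ((K₀ : ℝ) + n) ^ 2 * E' = νs j * (8 * Real.pi ^ 2 * ((K₀ : ℝ) + n) ^ 2 * E') := by ring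
    rw [e]; exact h1.le
  rw [hAd] at hP₂
  exact wien_member_no_floor (hν j) (hweak j) (hu j) (hCa j) hsa hsa1 hsa2 (hsymm j) (hcont j) (htrans j) hh hmean (hθ₀ j)
    hK₀1 hn1 hε hEE' hP₁ hP₂ hηc (hV j) (hfl j)

/-- The same through the clause bundle of `Negative.KillShape`: a candidate family of the crux whose
velocities are uniformly Wiener-class (one summable majorant with two moments) and whose variance is
bounded is not anomalous. [folklore] -/
theorem not_anomalous_of_isCandidate_wiener {g : UnitAddTorus (Fin 2) → EuclideanSpace ℝ (Fin 2)}
    (hadm : IsAdmissible g h) {ν : ℕ → ℝ}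
    {v₀ : ℕ → UnitAddTorus (Fin 2) → EuclideanSpace ℝ (Fin 2)} {v : ℕ → ℝ → UnitAddTorus (Fin 2) → EuclideanSpace ℝ (Fin 2)}
    {θ₀ : ℕ → UnitAddTorus (Fin 2) → ℝ} {θ : ℕ → ℝ → UnitAddTorus (Fin 2) → ℝ}
    (hcand : IsCandidate g h ν v₀ v θ₀ θ)
    (hsa : Summable a) (hsa1 : Summable fun q => (qrad q : ℝ) * a q) (hsa2 : Summable fun q => (qrad q : ℝ) ^ 2 * a q)
    {Cs : ℕ → ℝ → ℤ² → EuclideanSpace ℂ (Fin 2)} (hCa : ∀ j s q, ‖Cs j s q‖ ≤ a q)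
    (hsymm : ∀ j s q, Cs j s (-q) = EuclideanSpace.conjVec (Cs j s q)) (hcont : ∀ j q, Continuous fun s => Cs j s q)
    (htrans : ∀ j s q, zdot q (Cs j s q) = 0) (hv : ∀ j s, v j s = wienField (Cs j s))
    (hV : VarianceBounded θ) : ¬ Anomalous ν θ := by
  obtain ⟨E, hE⟩ := hV
  exact wiener_not_anomalous hadm.smooth_h hadm.zeroMean_h hsa hsa1 hsa2 hcand.pos hcand.tendsto hCa hsymm hcont htrans hv
    hcand.memLp hcand.weak hE

end WienNoGo

end Summit.AnomalousDissipation.AnomalousDissipation.Theorems.ScalarAnomalySteadySourceFormal.Negative
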